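import Mathlib
import Literature.Analysis.FluidPDE.ClassicalSolution
import Literature.Analysis.FluidPDE.LerayHopf
import Literature.Analysis.FluidPDE.LerayHopfProofs
import Literature.Analysis.FluidPDE.NSWave0
import Literature.Analysis.FluidPDE.SuitableWeak
import Literature.Analysis.FluidPDE.TaoLocalisation
import Summits.NavierStokesRegularity.NavierStokesRegularity.Theses.L3TimeExponentPincer
import Summits.NavierStokesRegularity.NavierStokesRegularity.Theorems.L3TimeExponentPincerEffNode
import HarnessLib.Audit
import HarnessLib

/-!
# BC5 rung (T3 witness) for crux `L3CascadeJaw` (route `L3TimeExponentPincer`): the Type-I case is TRUE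

In the route's Leray–Hopf frame, every solution that is (sup-norm) TYPE I at `T` — tree predicate
`Literature.Analysis.FluidPDE.IsTypeIBlowup u T` (`‖u(t,x)‖ ≤ C/√(T-t)` near `T`) — satisfies
`∫_{T₂}^{T} ‖u(t)‖₃^q dt < ∞` for EVERY `q ∈ [0,6)`, in particular on the jaw range `q ∈ (4,5)`
(`L3CascadeJaw_rung`).  Mechanism: energy inequality (`IsLerayHopfOn.lintegral_enorm_sq_le`) + the pointwise
bound give `‖u(t)‖₃³ ≤ ‖u(t)‖_∞ ‖u(t)‖₂² ≲ (T-t)^{-1/2}`, i.e. the `L³` RATE `θ = 1/6 < 1/5`, and `qθ < 1` for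
`q < 6` (`l3Hypothesis_of_rate` of `Theorems.L3TimeExponentPincerEffNode`).  Hence
`L3CascadeJaw_of_typeI : (every frame solution is Type I at T) → L3CascadeJaw`.

Why this is a witness of weakness (BC5 / tribunal T3): the Type-I regime is exactly where the summit (no blow-up)
is NOT known — excluding Type-I blow-up is hard core 0056 (Leray's question; KNSS 2009 axisymmetric only;
Seregin 2012 `L³`-bounded only) — yet the crux is DECIDED (true) there; the crux constrains only blow-up cascading
SLOWER than Euler speed (`θ > 1/5`), the regime of the damped averaged cascades (nsreg-p2 ROUND-3).
Cell ns-regularity-ideate seat p2 (BC5 file `route/bc/L3CascadeJaw_rung.lean` of the route's birth, re-homed to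
Theorems per DIRECTOR-NS 2026-08-26T00:04:37Z).
-/

noncomputable section

namespace Summit.NavierStokesRegularity.NavierStokesRegularity.Theorems.L3TimeExponentPincerTypeIRung

open scoped ENNReal NNReal Topology
open MeasureTheory Set Filter Literature.Analysis.FluidPDE
open Summit.NavierStokesRegularity.NavierStokesRegularity.Theorems.L3TimeExponentPincerEffNode

/-- Slice bound `‖v‖₃ ≤ (a ∫|v|²)^{1/3}` from a pointwise bound `|v| ≤ a` and the energy. -/
theorem eLpNorm_three_le_of_sup_of_energy {v : (EuclideanSpace ℝ (Fin 3)) → (EuclideanSpace ℝ (Fin 3))} {a : ℝ} {M : ℝ≥0∞} (ha : 0 ≤ a)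
    (hM : M ≠ ⊤) (hv : ∀ x, ‖v x‖ ≤ a) (hE : ∫⁻ x, ‖v x‖ₑ ^ 2 ≤ M) :
    eLpNorm v 3 volume ≤ ENNReal.ofReal ((a * M.toReal) ^ (1 / 3 : ℝ)) := by
  rw [eLpNorm_eq_lintegral_rpow_enorm_toReal (by norm_num) ENNReal.ofNat_ne_top,
    ENNReal.toReal_ofNat]
  have h3 : ∫⁻ x, ‖v x‖ₑ ^ (3 : ℝ) ≤ ENNReal.ofReal a * M := by
    calc ∫⁻ x, ‖v x‖ₑ ^ (3 : ℝ) = ∫⁻ x, ‖v x‖ₑ * ‖v x‖ₑ ^ 2 := by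
          refine lintegral_congr fun x => ?_
          rw [show (3 : ℝ) = ((3 : ℕ) : ℝ) by norm_num, ENNReal.rpow_natCast]
          ring
      _ ≤ ∫⁻ x, ENNReal.ofReal a * ‖v x‖ₑ ^ 2 := by
          refine lintegral_mono fun x => ?_
          have hx : ‖v x‖ₑ ≤ ENNReal.ofReal a := by
            rw [← ofReal_norm]; exact ENNReal.ofReal_le_ofReal (hv x)
          exact mul_le_mul' hx le_rfl
      _ = ENNReal.ofReal a * ∫⁻ x, ‖v x‖ₑ ^ 2 := lintegral_const_mul' _ _ ENNReal.ofReal_ne_top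
      _ ≤ ENNReal.ofReal a * M := by gcongr
  calc (∫⁻ x, ‖v x‖ₑ ^ (3 : ℝ)) ^ (1 / (3 : ℝ))
      ≤ (ENNReal.ofReal a * M) ^ (1 / (3 : ℝ)) := ENNReal.rpow_le_rpow h3 (by norm_num)
    _ = ENNReal.ofReal ((a * M.toReal) ^ (1 / 3 : ℝ)) := by
        have hM' : ENNReal.ofReal a * M = ENNReal.ofReal (a * M.toReal) := by
          rw [ENNReal.ofReal_mul ha, ENNReal.ofReal_toReal hM]
        rw [hM', ENNReal.ofReal_rpow_of_nonneg (by positivity) (by norm_num)]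

/-- **BC5 RUNG (PROVED).**  The Type-I case of `L3CascadeJaw`, for every `q ∈ [0,6)` ⊋ `(4,5)`:
a Leray–Hopf solution (`ν > 0`, `f = 0`) that is sup-norm Type I at `T` has `∫_{T₂}^T ‖u(t)‖₃^q dt < ∞`
on a final window.  Only the energy inequality and the pointwise rate are used (L³ rate `θ = 1/6`). -/
theorem L3CascadeJaw_rung (q : ℝ) (hq0 : 0 ≤ q) (hq : q < 6) (ν T : ℝ) (hν : 0 < ν) (hT : 0 < T)
    (u : ℝ → (EuclideanSpace ℝ (Fin 3)) → (EuclideanSpace ℝ (Fin 3))) (hLH : IsLerayHopfOn T ν 0 (u 0) u) (hTI : IsTypeIBlowup u T) :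
    ∃ T₂ ∈ Ioo 0 T, (∫⁻ t in Ioo T₂ T, eLpNorm (u t) 3 volume ^ q) < ⊤ := by
  obtain ⟨C, hev⟩ := hTI
  obtain ⟨l, hlT, hl⟩ := (mem_nhdsLT_iff_exists_Ioo_subset).1 hev
  set M : ℝ≥0∞ := ENNReal.ofReal (2 * VectorCalculus.kineticEnergy (u 0)) with hMdef
  have hMtop : M ≠ ⊤ := ENNReal.ofReal_ne_top
  have hM : ∀ t ∈ Icc 0 T, ∫⁻ x, ‖u t x‖ₑ ^ 2 ≤ M := fun t ht =>
    hLH.lintegral_enorm_sq_le hν.le ht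
  set m : ℝ := max l 0 with hm
  have hmT : m < T := max_lt hlT hT
  set T₂ : ℝ := (m + T) / 2 with hT₂
  have hT₂m : m < T₂ := by rw [hT₂]; linarith
  have hT₂T : T₂ < T := by rw [hT₂]; linarith
  have hT₂0 : 0 < T₂ := lt_of_le_of_lt (le_max_right l 0) hT₂m
  have hT₂l : l < T₂ := lt_of_le_of_lt (le_max_left l 0) hT₂m
  refine ⟨T₂, ⟨hT₂0, hT₂T⟩, ?_⟩
  set K : ℝ := (|C| * M.toReal) ^ (1 / 3 : ℝ) with hK
  have hK0 : 0 ≤ K := by positivity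
  refine l3Hypothesis_of_rate hT₂T hq0 (θ := 1 / 6) (by linarith) hK0 fun t ht => ?_
  have hσ : 0 < T - t := by linarith [ht.2]
  have htl : t ∈ Ioo l T := ⟨lt_of_lt_of_le hT₂l ht.1, ht.2⟩
  have hpt : ∀ x, ‖u t x‖ ≤ |C| / Real.sqrt (T - t) := fun x =>
    (hl htl x).trans (div_le_div_of_nonneg_right (le_abs_self C) (Real.sqrt_nonneg _))
  have hEt : ∫⁻ x, ‖u t x‖ₑ ^ 2 ≤ M := hM t ⟨hT₂0.le.trans ht.1, ht.2.le⟩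
  have h := eLpNorm_three_le_of_sup_of_energy (by positivity) hMtop hpt hEt
  refine h.trans (le_of_eq ?_)
  congr 1
  rw [hK, Real.sqrt_eq_rpow, div_eq_mul_inv, ← Real.rpow_neg hσ.le,
    show |C| * (T - t) ^ (-(1 / 2 : ℝ)) * M.toReal = (|C| * M.toReal) * (T - t) ^ (-(1 / 2 : ℝ)) by ring,
    Real.mul_rpow (by positivity) (Real.rpow_nonneg hσ.le _), ← Real.rpow_mul hσ.le]
  norm_num

/-- The rung restricted to the jaw range and dressed in the route's exact frame hypotheses (the
classical-solution and decay hypotheses are carried, not used): "all solutions of the frame are sup-Type-I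
at `T`" ⇒ the conclusion of `L3CascadeJaw` — i.e. `L3CascadeJaw` is a consequence of the Type-I
hypothesis, a regime where no-blow-up is open. -/
theorem L3CascadeJaw_of_typeI
    (hTI : ∀ (ν T : ℝ), 0 < ν → 0 < T → ∀ (u : ℝ → (EuclideanSpace ℝ (Fin 3)) → (EuclideanSpace ℝ (Fin 3))) (p : ℝ → (EuclideanSpace ℝ (Fin 3)) → ℝ),
      IsClassicalNSSolutionOn (Ico 0 T) ν 0 u p → IsLerayHopfOn T ν 0 (u 0) u →
      HasRapidSpatialDecay (u 0) → IsTypeIBlowup u T) :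
    Summit.NavierStokesRegularity.NavierStokesRegularity.Theses.L3TimeExponentPincer.L3CascadeJaw :=
  fun q hq4 hq5 ν T hν hT u p hcl hLH hdec =>
    L3CascadeJaw_rung q (by linarith) (by linarith) ν T hν hT u hLH (hTI ν T hν hT u p hcl hLH hdec)

end Summit.NavierStokesRegularity.NavierStokesRegularity.Theorems.L3TimeExponentPincerTypeIRung

end
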